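import Literature.NumberTheory.NumberFields.RingClassFieldOfConductor
import Literature.NumberTheory.LFunctions.PrimesInRayClasses
import Literature.NumberTheory.GaloisRepresentations.FrobeniusDensityTheorem
import HarnessLib

/-!
# The ring class field of conductor `f` has degree `h(𝒪) = #(I_K(f)/P_{K,ℤ}(f))` over `K`
# (Cox, *Primes of the form x² + ny²*, §9.A with Thm. 8.2 / Cor. 8.7: `Gal(L/K) ≃ I_K(f)/P_{K,ℤ}(f)`)

Topic `NumberTheory/NumberFields` (class field theory); sequel of `RingClassFieldOfConductor.lean`.
Theorems only — no definition, no named fact (D-0026); unconditional.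

> Cox, §9.A (p. 180): "the ring class field of the order `𝒪 = ℤ + f𝒪_K` is the unique Abelian
> extension `L` of `K`" with "`Gal(L/K) ≃ C(𝒪) ≃ I_K(f)/P_{K,ℤ}(f)`"; Thm. 8.2 / Cor. 8.7 (the
> Existence Theorem and the order of the Galois group of the class field of a congruence subgroup:
> `[L : K] = [I_K(𝔪) : H]`); §8.B Thm. 8.19: a finite extension is determined by (the density of)
> the primes that split completely in it.

`RingClassFieldOfConductor.exists_ringClassField_data` produces a finite Galois `R ⊆ K̄` over `K`,
unramified off `f`, in which a prime `v ∤ f` splits completely iff its ring class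
`[𝔭_v] ∈ I_K(f)/P_{K,ℤ}(f)` is trivial.  Here we prove that ANY finite Galois `R/K` with this
splitting law has

  `[R : K] = #(I_K(f)/P_{K,ℤ}(f))`   (`finrank_eq_card_ringClassGroup_of_splitPrimes_iff`),

by comparing Dirichlet densities (the argument of Cox Thm. 8.19 / Neukirch VII (13.9)): the primes
splitting completely in `R` have density `1/[R : K]` (tree `hasStrongDirichletDensity_splitPrimes`,
Marcus Thm. 43), while the primes `v ∤ f` with `[𝔭_v] = 1` have density `1/#(I_K(f)/P_{K,ℤ}(f))`
by Landau's equidistribution of primes in (ring) classes (tree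
`hasStrongDirichletDensity_frobFiber_of_artinKillsRay`, fed with `artinKillsRay_primeClass` and the
fact that the prime classes generate the ring class group, `primeClass_generate`); the two sets
agree off the finitely many `v ∣ f`, and a set of primes has at most one density
(tree `HasStrongDirichletDensity.unique`, `CyclotomicFrobeniusNorm`).  Packaged: `exists_ringClassField_data_finrank` — the ring class field
data of `RingClassFieldOfConductor` together with `[R : K] = #(I_K(f)/P_{K,ℤ}(f))` and
`#Gal(R/K) = #(I_K(f)/P_{K,ℤ}(f))`.

For `K` imaginary quadratic this is `[R : K] = h(f² d_K)` (tree
`RingClassForms.classNumber_eq_card_ringClassGroup`), the degree half of Cox Thm. 11.1 used in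
`EllipticCurves/RingClassFieldDegree.lean`.

## Mathlib / tree search

Tree: `RingClassField.primeClass`, `idealClass`, `artinSymbol_primeClass_eq_idealClass`,
`artinKillsRay_primeClass`, `exists_ringClassField_data` (`RingClassFieldOfConductor`);
`RingClass.exists_eq_mul_inv_of_mem_ringClassNum`, `mk0_mem_ringClassNum` (`QuadraticFields/RingClassGroup`);
`hasStrongDirichletDensity_frobFiber_of_artinKillsRay`, `exists_charFun_primeRayClass_ne_one` (the ray
template), `frobFiber` (`LFunctions/PrimesInRayClasses`, `AbelianFrobeniusDensity`);
`hasStrongDirichletDensity_splitPrimes` (`GaloisRepresentations/FrobeniusDensityTheorem`);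
`HasStrongDirichletDensity.of_finite_symmDiff` (`LFunctions/PrimeLogDensity`), `HasStrongDirichletDensity.unique`
(`GaloisRepresentations/CyclotomicFrobeniusNorm`); `finite_setOf_le_asIdeal`.
`lean search 'finrank.*RingClassGroup|card_aut.*ringClass'`: nothing prior.

## References

* D. A. Cox, *Primes of the form x² + ny²*, 2nd ed., Wiley (2013): §8.A Thm. 8.2, Cor. 8.7; §8.B
  Thm. 8.19; §9.A (p. 180–181). [Cox2013]
* J. Neukirch, *Algebraic Number Theory* (1999), Ch. VI §6 (6.2)–(6.3), §7 (7.1); Ch. VII §13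
  (13.2), (13.9). [NeukirchANT1999]
-/

noncomputable section

open NumberField IsDedekindDomain IsDedekindDomain.HeightOneSpectrum Filter Field Topology
open scoped nonZeroDivisors

namespace Literature.NumberTheory.NumberFields

namespace RingClassField

open Literature.NumberTheory.GaloisRepresentations Literature.NumberTheory.Automorphic
  Literature.NumberTheory.LFunctions Literature.NumberTheory.LFunctions.AbelianDensity
  Literature.NumberTheory.QuadraticFields.RingClass

variable {K : Type} [Field K] [NumberField K] (f : ℕ)

/-! ### The prime classes generate the ring class group -/

/-- **The classes `[𝔭]`, `𝔭 ∤ f`, generate `I_K(f)/P_{K,ℤ}(f)`** (Cox Prop. 7.20: `I_K(f)` is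
generated by the primes not dividing `f`): every element of the ring class group is `[𝔄][𝔅]⁻¹` for
integral ideals `𝔄, 𝔅` prime to `f` (`RingClass.exists_eq_mul_inv_of_mem_ringClassNum`), and
`[𝔄] = ∏_𝔭 [𝔭]^{ν_𝔭(𝔄)}` (`artinSymbol_primeClass_eq_idealClass`).
[cite: Cox2013, §7.C Prop. 7.20 and Prop. 7.22] -/
theorem primeClass_generate (H : Subgroup (RingClassGroup K f))
    (hH : ∀ v : HeightOneSpectrum (𝓞 K), ¬ Ideal.span {(f : 𝓞 K)} ≤ v.asIdeal → primeClass f v ∈ H) :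
    H = ⊤ := by
  classical
  -- every prime class lies in `H` (the value at `𝔭 ∣ f` is `1`)
  have hall : ∀ v : HeightOneSpectrum (𝓞 K), primeClass f v ∈ H := fun v => by
    by_cases hv : v.asIdeal ⊔ Ideal.span {(f : 𝓞 K)} = ⊤
    · exact hH v ((sup_span_eq_top_iff_not_le f).mp hv)
    · rw [primeClass_of_sup_ne_top f hv]; exact H.one_mem
  -- hence the class of every integral ideal prime to `f`
  have hideal : ∀ {I : Ideal (𝓞 K)} (hI : I ≠ ⊥) (hcop : I ⊔ Ideal.span {(f : 𝓞 K)} = ⊤),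
      idealClass f hI hcop ∈ H := by
    intro I hI hcop
    rw [← artinSymbol_primeClass_eq_idealClass f hI hcop, artinSymbol]
    exact finprod_induction (· ∈ H) H.one_mem (fun _ _ hx hy ↦ H.mul_mem hx hy)
      fun v ↦ H.pow_mem (hall v) _
  rw [eq_top_iff]
  rintro g -
  obtain ⟨⟨u, hu⟩, rfl⟩ := QuotientGroup.mk_surjective g
  obtain ⟨s, hs, t, ht, hust⟩ := exists_eq_mul_inv_of_mem_ringClassNum hu
  obtain ⟨𝔄, h𝔄, hs𝔄⟩ := hs
  obtain ⟨𝔅, h𝔅, ht𝔅⟩ := ht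
  have h𝔄0 : 𝔄 ≠ ⊥ := by
    intro h
    apply s.ne_zero
    rw [hs𝔄, h, FractionalIdeal.coeIdeal_bot]
  have h𝔅0 : 𝔅 ≠ ⊥ := by
    intro h
    apply t.ne_zero
    rw [ht𝔅, h, FractionalIdeal.coeIdeal_bot]
  have hs' : s = FractionalIdeal.mk0 K ⟨𝔄, mem_nonZeroDivisors_of_ne_bot h𝔄0⟩ :=
    Units.ext (by rw [hs𝔄, FractionalIdeal.coe_mk0])
  have ht' : t = FractionalIdeal.mk0 K ⟨𝔅, mem_nonZeroDivisors_of_ne_bot h𝔅0⟩ :=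
    Units.ext (by rw [ht𝔅, FractionalIdeal.coe_mk0])
  have hsN : FractionalIdeal.mk0 K ⟨𝔄, mem_nonZeroDivisors_of_ne_bot h𝔄0⟩ ∈ ringClassNum K f :=
    mk0_mem_ringClassNum h𝔄 h𝔄0
  have htN : FractionalIdeal.mk0 K ⟨𝔅, mem_nonZeroDivisors_of_ne_bot h𝔅0⟩ ∈ ringClassNum K f :=
    mk0_mem_ringClassNum h𝔅 h𝔅0
  have hg : (QuotientGroup.mk ⟨u, hu⟩ : RingClassGroup K f) =
      idealClass f h𝔄0 h𝔄 * (idealClass f h𝔅0 h𝔅)⁻¹ := by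
    rw [idealClass_eq, idealClass_eq, ← QuotientGroup.mk_inv, ← QuotientGroup.mk_mul]
    congr 1
    apply Subtype.ext
    change u = _
    rw [hust, hs', ht']
    rfl
  rw [hg]
  exact H.mul_mem (hideal h𝔄0 h𝔄) (H.inv_mem (hideal h𝔅0 h𝔅))

/-- A non-trivial character of `I_K(f)/P_{K,ℤ}(f)` is `≠ 1` at the class of some prime `𝔭 ∤ f`
(the prime classes generate; the ring-class analogue of the tree's
`exists_charFun_primeRayClass_ne_one`). [cite: Cox2013, §7.C Prop. 7.20] -/
theorem exists_charFun_primeClass_ne_one (χ : AddChar (Additive (RingClassGroup K f)) ℂ) (hχ : χ ≠ 0) :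
    ∃ v : HeightOneSpectrum (𝓞 K), ¬ Ideal.span {(f : 𝓞 K)} ≤ v.asIdeal ∧
      χ (Additive.ofMul (primeClass f v)) ≠ 1 := by
  by_contra hall
  push Not at hall
  set H : Subgroup (RingClassGroup K f) :=
    (toMulHom (G := RingClassGroup K f) χ).toHomUnits.ker with hH
  have hmem : ∀ g : RingClassGroup K f, g ∈ H ↔ χ (Additive.ofMul g) = 1 := fun g ↦ by
    rw [hH, MonoidHom.mem_ker, Units.ext_iff, MonoidHom.coe_toHomUnits, toMulHom_apply, Units.val_one]
  have hHtop : H = ⊤ := primeClass_generate f H fun v hv ↦ (hmem (primeClass f v)).mpr (hall v hv)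
  apply hχ
  rw [AddChar.eq_zero_iff]
  intro x
  have hx : Additive.toMul x ∈ H := by rw [hHtop]; exact Subgroup.mem_top _
  rw [hmem] at hx
  simpa only [ofMul_toMul] using hx

/-! ### The primes with trivial ring class have density `1/#(I_K(f)/P_{K,ℤ}(f))` -/

/-- **Landau equidistribution in ring classes**: the primes `𝔭 ∤ f` with `[𝔭] = 1` in
`I_K(f)/P_{K,ℤ}(f)` have strong Dirichlet density `1/#(I_K(f)/P_{K,ℤ}(f))` (the tree's
`hasStrongDirichletDensity_frobFiber_of_artinKillsRay` for the datum `𝔭 ↦ [𝔭]`, which kills the ray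
`mod f𝓞_K` by `artinKillsRay_primeClass`; Cox Thm. 9.12 / 8.17 for the density of primes in a class).
[cite: Cox2013, §8.B Thm. 8.17 and §9.B Thm. 9.12] [cite: Landau1918Idealklassen, §1 Satz] -/
theorem hasStrongDirichletDensity_primeClass_eq_one [Finite (RingClassGroup K f)] (hf : f ≠ 0) :
    HasStrongDirichletDensity K
      {v : HeightOneSpectrum (𝓞 K) | ¬ Ideal.span {(f : 𝓞 K)} ≤ v.asIdeal ∧ primeClass f v = 1}
      (1 / Nat.card (RingClassGroup K f)) := by
  have h𝔪 : Ideal.span {(f : 𝓞 K)} ≠ ⊥ := by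
    rw [Ne, Ideal.span_singleton_eq_bot]
    exact_mod_cast hf
  exact hasStrongDirichletDensity_frobFiber_of_artinKillsRay h𝔪 (artinKillsRay_primeClass (K := K) f)
    (fun χ hχ ↦ exists_charFun_primeClass_ne_one f χ hχ) 1

/-! ### The degree of a Galois extension with the ring-class splitting law -/

/-- **`[R : K] = #(I_K(f)/P_{K,ℤ}(f))` for every finite Galois `R/K` in which a prime `v ∤ f` splits
completely iff `[𝔭_v] = 1`** (Cox §9.A with Thm. 8.2 / Cor. 8.7: `Gal(L/K) ≃ I_K(f)/P_{K,ℤ}(f)` for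
the ring class field; here for any `R` with its splitting law, by the density argument of Thm. 8.19:
`1/[R : K] = δ(Spl(R/K)) = δ{𝔭 : [𝔭] = 1} = 1/#(I_K(f)/P_{K,ℤ}(f))`).
[cite: Cox2013, §9.A (Gal(L/K) ≃ I_K(f)/P_{K,ℤ}(f)), §8.A Cor. 8.7, §8.B Thm. 8.19] -/
theorem finrank_eq_card_ringClassGroup_of_splitPrimes_iff [Finite (RingClassGroup K f)] (hf : f ≠ 0)
    (R : Type) [Field R] [NumberField R] [Algebra K R] [IsGalois K R]
    (hsplit : ∀ v : HeightOneSpectrum (𝓞 K), ¬ Ideal.span {(f : 𝓞 K)} ≤ v.asIdeal →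
      (v ∈ splitPrimes K R ↔ primeClass f v = 1)) :
    Module.finrank K R = Nat.card (RingClassGroup K f) := by
  have h𝔪 : Ideal.span {(f : 𝓞 K)} ≠ ⊥ := by
    rw [Ne, Ideal.span_singleton_eq_bot]
    exact_mod_cast hf
  have hX := hasStrongDirichletDensity_primeClass_eq_one (K := K) f hf
  have hY : HasStrongDirichletDensity K (splitPrimes K R) (1 / Nat.card (RingClassGroup K f)) :=
    hX.of_finite_symmDiff (finite_setOf_le_asIdeal h𝔪) fun q hq => by
      rw [Set.mem_setOf_eq] at hq
      rw [Set.mem_setOf_eq, hsplit q hq]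
      exact ⟨fun h => h.2, fun h => ⟨hq, h⟩⟩
  have hY' := hasStrongDirichletDensity_splitPrimes K R
  have heq := hY'.unique hY
  have h1 : (0 : ℝ) < Module.finrank K R := by exact_mod_cast Module.finrank_pos
  have h2 : (0 : ℝ) < Nat.card (RingClassGroup K f) := by exact_mod_cast Nat.card_pos
  rw [div_eq_div_iff h1.ne' h2.ne', one_mul, one_mul] at heq
  exact_mod_cast heq.symm

/-- **`#Gal(R/K) = #(I_K(f)/P_{K,ℤ}(f))`** under the same hypotheses (Cox §9.A:
`Gal(L/K) ≃ I_K(f)/P_{K,ℤ}(f)`; here only the equality of orders). [cite: Cox2013, §9.A and §8.A Cor. 8.7] -/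
theorem card_aut_eq_card_ringClassGroup_of_splitPrimes_iff [Finite (RingClassGroup K f)] (hf : f ≠ 0)
    (R : Type) [Field R] [NumberField R] [Algebra K R] [IsGalois K R]
    (hsplit : ∀ v : HeightOneSpectrum (𝓞 K), ¬ Ideal.span {(f : 𝓞 K)} ≤ v.asIdeal →
      (v ∈ splitPrimes K R ↔ primeClass f v = 1)) :
    Nat.card (R ≃ₐ[K] R) = Nat.card (RingClassGroup K f) := by
  rw [IsGalois.card_aut_eq_finrank, finrank_eq_card_ringClassGroup_of_splitPrimes_iff f hf R hsplit]

/-- **The ring class field of conductor `f` and its degree.**  For a number field `K` and `f ≠ 0`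
with `I_K(f)/P_{K,ℤ}(f)` finite: a finite Galois `R ⊆ K̄` over `K`, unramified at every `v ∤ f`, in
which a prime `v ∤ f` splits completely iff `[𝔭_v] = 1` — the tree's `exists_ringClassField_data` —
has `[R : K] = #(I_K(f)/P_{K,ℤ}(f)) = #Gal(R/K)` (Cox §9.A: "the ring class field … `Gal(L/K) ≃
C(𝒪) ≃ I_K(f)/P_{K,ℤ}(f)`"; for `K` imaginary quadratic `= h(f² d_K)` by the tree's
`RingClassForms.classNumber_eq_card_ringClassGroup`).
[cite: Cox2013, §9.A (p. 180–181), §8.A Thm. 8.2 and Cor. 8.7] [cite: NeukirchANT1999, Ch. VI §6 (6.2)–(6.3), §7 Thm. (7.1)] -/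
theorem exists_ringClassField_data_finrank [Finite (RingClassGroup K f)] (hf : f ≠ 0) :
    ∃ R : IntermediateField K (AlgebraicClosure K), FiniteDimensional K R ∧ IsGalois K R ∧
      (∀ v : HeightOneSpectrum (𝓞 K), ¬ Ideal.span {(f : 𝓞 K)} ≤ v.asIdeal →
        Algebra.IsUnramifiedIn (𝓞 R) v.asIdeal) ∧
      (∀ v : HeightOneSpectrum (𝓞 K), ¬ Ideal.span {(f : 𝓞 K)} ≤ v.asIdeal →
        (v ∈ splitPrimes K R ↔ primeClass f v = 1)) ∧
      Module.finrank K R = Nat.card (RingClassGroup K f) ∧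
      Nat.card (R ≃ₐ[K] R) = Nat.card (RingClassGroup K f) := by
  obtain ⟨R, hRfd, hRgal, hunr, hsplit⟩ := exists_ringClassField_data (K := K) f hf
  haveI := hRfd
  haveI := hRgal
  haveI : NumberField R := NumberField.of_module_finite K R
  exact ⟨R, hRfd, hRgal, hunr, hsplit, finrank_eq_card_ringClassGroup_of_splitPrimes_iff f hf R hsplit,
    card_aut_eq_card_ringClassGroup_of_splitPrimes_iff f hf R hsplit⟩

end RingClassField

end Literature.NumberTheory.NumberFields

end
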